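import Summits.ResolutionOfSingularities.ResolutionOfSingularities.Theorems.FrobeniusLadderFInjectiveMacaulayficationP3d4z4557NewtonKFanTablesB
import Summits.ResolutionOfSingularities.ResolutionOfSingularities.Theorems.FrobeniusLadderFInjectiveMacaulayficationP3d4z4557NewtonKNewtonTables
import Summits.ResolutionOfSingularities.ResolutionOfSingularities.Theorems.FrobeniusLadderFInjectiveMacaulayficationFanCheckChunks
import HarnessLib

/-!
# HEAVY KERNEL CHECKS (fan side) of the BED W class-route certificate: shapes, (hgen), unimodularity, vertex bridge, pure powers, (hAJ), the vertex property (hge)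
# RAY-CHUNK BY RAY-CHUNK, the local-matrix bridge `hVq` and the NEWTON MINIMISER check — each ONE `decide +kernel` on the tables of `P3d4z4557NewtonKFanTables` / `…FanTablesB` / `…NewtonTables`
# (crux `FInjectiveMacaulayfication` stmt-ResolutionOfSingularities-15315, chain w45a; (W-WND) BED W class-route twin, res-L1-w45a-plan-1 R22.2 (1); seat res-L1-w45a-stub-3 g12)

Support file for crux stmt-ResolutionOfSingularities-15315 (`FrobeniusLadder.FInjectiveMacaulayfication`), chain w45a.
[OURS · L1 W4.5a] — NOT a statement of any manuscript; AI-written, weaker than expert review.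

The Boolean checks of res-L1-w45a-stub-4's `FanCheckKit` (+ res-L1-w45a-stub-2's `FanCheckMulti` / `FanCheckChunks`) on the BED W class-route data (`f_W = z³+x⁴+y⁵+u⁵+t⁷`, char 3,
res-L1-w45a-stub-3's `Σ_f ∧ Σ(𝔪)` fan, 441 charts, centre `𝔪·K` with `|K| = 2651`, 13255 generators; kit job j319966, certificate sha16 a98d81bea63a2372): `checkShapes` (no exceptional vectors, `r = 0`),
`CL.length = 441`, `checkHgen`, `checkDetUnit`, `FanCheckMulti.checkMVBridge`, `checkHprim`, `checkHAJ`, the length check of `KL2`, the vertex property `checkHge` as 13 ray-chunk checks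
`checkHgeFrom AL2 CL (6k) RAYS_k` glued by `FanCheckChunks.checkHgeFrom_append_true`, the bridge `Vq c = chartV 5 RAYS CL 441 c`, and the NEWTON MINIMISER check
(`U0 c ∈ SUPPv` minimises every row functional of `Vq c` over `SUPPv` — the fan refines `Σ_f`). The cover records are checked in `P3d4z4557NewtonKCoverChecks`; the binders are `P3d4z4557NewtonKFan`.
No definitions, no named facts. [folklore; cite: CoxLittleSchenck2011, §2.3]
-/

-- single-problem summit: the doubled namespace component is forced
set_option linter.dupNamespace false

namespace Summit.ResolutionOfSingularities.ResolutionOfSingularities.Theorems.FInjectiveMacaulayfication.P3d4z4557NewtonKFan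

open Summit.ResolutionOfSingularities.ResolutionOfSingularities.Theorems.FInjectiveMacaulayfication
open FanCheckKit FanCheckSound

/-! ## Light checks (ONE `decide`; bundled with `CL.length = 441`, which keeps every statement distinct from the sibling fan modules) -/

/-- (tlen, shapes, lengths of `K`'s table): light fan-side checks I. -/
theorem fan_checks_a : CL.length = 441 ∧ checkShapes 5 0 AL2 RAYS CL = true ∧ (KL2.all fun ch => allLen 5 ch) = true := by
  decide +kernel

/-- (tlen, hgen, hV, vertex bridge): light fan-side checks II. -/
theorem fan_checks_b : CL.length = 441 ∧ checkHgen 5 AL2 RAYS CL = true ∧ checkDetUnit 5 RAYS CL VinvTL = true ∧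
    FanCheckMulti.checkMVBridge 5 AL2 MV2 50 441 CL = true := by
  decide +kernel

/-- (tlen, hprim, hAJ): light fan-side checks III. -/
theorem fan_checks_c : CL.length = 441 ∧ checkHprim 5 AL2 PJ = true ∧ checkHAJ AL2 = true := by
  decide +kernel

/-- 441 charts. -/
theorem tlen : CL.length = 441 := fan_checks_a.1

/-- (shapes) lengths and index bounds of all tables. -/
theorem shapes : checkShapes 5 0 AL2 RAYS CL = true ∧ CL.length = 441 := ⟨fan_checks_a.2.1, tlen⟩

/-- (hgen) `V c · a c i = V c · m c + e_i`. -/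
theorem check_hgen : checkHgen 5 AL2 RAYS CL = true ∧ CL.length = 441 := ⟨fan_checks_b.2.1, tlen⟩

/-- (hV) `V c · W c = 1` over `ℤ`. -/
theorem check_det : checkDetUnit 5 RAYS CL VinvTL = true ∧ CL.length = 441 := ⟨fan_checks_b.2.2.1, tlen⟩

/-- The vertex table `MV2` agrees with the chart records. -/
theorem check_mvbridge : FanCheckMulti.checkMVBridge 5 AL2 MV2 50 441 CL = true := fan_checks_b.2.2.2

/-- (hprim) pure powers of all five variables among the generators. -/
theorem check_hprim : checkHprim 5 AL2 PJ = true ∧ CL.length = 441 := ⟨fan_checks_c.2.1, tlen⟩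

/-- (hAJ) no generator is `0`. -/
theorem check_hAJ : checkHAJ AL2 = true ∧ CL.length = 441 := ⟨fan_checks_c.2.2, tlen⟩

/-- Every chunk of `K`'s table consists of vectors of length 5. -/
theorem check_klen : (KL2.all fun ch => allLen 5 ch) = true ∧ CL.length = 441 := ⟨fan_checks_a.2.2, tlen⟩

/-- 78 rays in 13 chunks of 6. -/
theorem rlens : RAYS_0.length = 6 ∧ RAYS_1.length = 6 ∧ RAYS_2.length = 6 ∧ RAYS_3.length = 6 ∧ RAYS_4.length = 6 ∧ RAYS_5.length = 6 ∧ RAYS_6.length = 6 ∧ RAYS_7.length = 6 ∧ RAYS_8.length = 6 ∧ RAYS_9.length = 6 ∧ RAYS_10.length = 6 ∧ RAYS_11.length = 6 ∧ RAYS_12.length = 6 := by decide +kernel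

/-! ## (hge) ray-chunk by ray-chunk -/

/-- (hge), rays 0–5 (with the specimen-distinct conjunct `CL.length = 441`). -/
theorem check_hge_0 : checkHgeFrom AL2 CL 0 RAYS_0 = true ∧ CL.length = 441 := ⟨by decide +kernel, tlen⟩

/-- (hge), rays 6–11. -/
theorem check_hge_1 : checkHgeFrom AL2 CL 6 RAYS_1 = true := by decide +kernel

/-- (hge), rays 12–17. -/
theorem check_hge_2 : checkHgeFrom AL2 CL 12 RAYS_2 = true := by decide +kernel

/-- (hge), rays 18–23. -/
theorem check_hge_3 : checkHgeFrom AL2 CL 18 RAYS_3 = true := by decide +kernel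

/-- (hge), rays 24–29. -/
theorem check_hge_4 : checkHgeFrom AL2 CL 24 RAYS_4 = true := by decide +kernel

/-- (hge), rays 30–35. -/
theorem check_hge_5 : checkHgeFrom AL2 CL 30 RAYS_5 = true := by decide +kernel

/-- (hge), rays 36–41. -/
theorem check_hge_6 : checkHgeFrom AL2 CL 36 RAYS_6 = true := by decide +kernel

/-- (hge), rays 42–47. -/
theorem check_hge_7 : checkHgeFrom AL2 CL 42 RAYS_7 = true := by decide +kernel

/-- (hge), rays 48–53. -/
theorem check_hge_8 : checkHgeFrom AL2 CL 48 RAYS_8 = true := by decide +kernel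

/-- (hge), rays 54–59. -/
theorem check_hge_9 : checkHgeFrom AL2 CL 54 RAYS_9 = true := by decide +kernel

/-- (hge), rays 60–65. -/
theorem check_hge_10 : checkHgeFrom AL2 CL 60 RAYS_10 = true := by decide +kernel

/-- (hge), rays 66–71. -/
theorem check_hge_11 : checkHgeFrom AL2 CL 66 RAYS_11 = true := by decide +kernel

/-- (hge), rays 72–77. -/
theorem check_hge_12 : checkHgeFrom AL2 CL 72 RAYS_12 = true := by decide +kernel

/-- ★ (hge) the vertex property on all 78 rays, glued from the 13 chunks (with the specimen-distinct conjunct `CL.length = 441`). -/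
theorem check_hge : checkHge AL2 RAYS CL = true ∧ CL.length = 441 := by
  refine ⟨?_, tlen⟩
  obtain ⟨h0, h1, h2, h3, h4, h5, h6, h7, h8, h9, h10, h11, h12⟩ := rlens
  rw [checkHge, RAYS]
  refine FanCheckChunks.checkHgeFrom_append_true (FanCheckChunks.checkHgeFrom_append_true (FanCheckChunks.checkHgeFrom_append_true (FanCheckChunks.checkHgeFrom_append_true (FanCheckChunks.checkHgeFrom_append_true (FanCheckChunks.checkHgeFrom_append_true (FanCheckChunks.checkHgeFrom_append_true (FanCheckChunks.checkHgeFrom_append_true (FanCheckChunks.checkHgeFrom_append_true (FanCheckChunks.checkHgeFrom_append_true (FanCheckChunks.checkHgeFrom_append_true (FanCheckChunks.checkHgeFrom_append_true check_hge_0.1 ?_) ?_) ?_) ?_) ?_) ?_) ?_) ?_) ?_) ?_) ?_) ?_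
  · rw [h0]; exact check_hge_1
  · rw [List.length_append, h0, h1]; exact check_hge_2
  · rw [List.length_append, List.length_append, h0, h1, h2]; exact check_hge_3
  · rw [List.length_append, List.length_append, List.length_append, h0, h1, h2, h3]; exact check_hge_4
  · rw [List.length_append, List.length_append, List.length_append, List.length_append, h0, h1, h2, h3, h4]; exact check_hge_5
  · rw [List.length_append, List.length_append, List.length_append, List.length_append, List.length_append, h0, h1, h2, h3, h4, h5]; exact check_hge_6
  · rw [List.length_append, List.length_append, List.length_append, List.length_append, List.length_append, List.length_append, h0, h1, h2, h3, h4, h5, h6]; exact check_hge_7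
  · rw [List.length_append, List.length_append, List.length_append, List.length_append, List.length_append, List.length_append, List.length_append, h0, h1, h2, h3, h4, h5, h6, h7]; exact check_hge_8
  · rw [List.length_append, List.length_append, List.length_append, List.length_append, List.length_append, List.length_append, List.length_append, List.length_append, h0, h1, h2, h3, h4, h5, h6, h7, h8]; exact check_hge_9
  · rw [List.length_append, List.length_append, List.length_append, List.length_append, List.length_append, List.length_append, List.length_append, List.length_append, List.length_append, h0, h1, h2, h3, h4, h5, h6, h7, h8, h9]; exact check_hge_10
  · rw [List.length_append, List.length_append, List.length_append, List.length_append, List.length_append, List.length_append, List.length_append, List.length_append, List.length_append, List.length_append, h0, h1, h2, h3, h4, h5, h6, h7, h8, h9, h10]; exact check_hge_11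
  · rw [List.length_append, List.length_append, List.length_append, List.length_append, List.length_append, List.length_append, List.length_append, List.length_append, List.length_append, List.length_append, List.length_append, h0, h1, h2, h3, h4, h5, h6, h7, h8, h9, h10, h11]; exact check_hge_12

/-! ## The Newton side: local matrices and minimisers -/

/-- The local matrix table agrees with `chartV 5 RAYS CL 441`. -/
theorem hVq : ∀ c : Fin 441, Vq c = chartV 5 RAYS CL 441 c := by decide +kernel

/-- Every Newton minimiser is a support vector of `f_W`. -/
theorem hU0_mem : ∀ c : Fin 441, U0 c ∈ SUPPv := by decide +kernel

/-- ★ THE NEWTON MINIMISER CHECK (the fan refines `Σ_f`): on every chart, `U0 c` minimises every row functional of `Vq c` over the support of `f_W` (explicit dot products). -/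
theorem hmin_raw : ∀ c : Fin 441, ∀ i : Fin 5, ∀ u ∈ SUPPv,
    Vq c i 0 * U0 c 0 + Vq c i 1 * U0 c 1 + Vq c i 2 * U0 c 2 + Vq c i 3 * U0 c 3 + Vq c i 4 * U0 c 4 ≤
      Vq c i 0 * u 0 + Vq c i 1 * u 1 + Vq c i 2 * u 2 + Vq c i 3 * u 3 + Vq c i 4 * u 4 := by
  decide +kernel

/-- The pure powers `x_j^(N_j)` in `K` (the last five generators), as a membership check on the flattened table — so `𝔪 ⊆ √K`. -/
theorem hKpow : (Pi.single 0 1222 : Fin 5 → ℕ) ∈ KL2.flatten.map (vecOf 5) ∧ (Pi.single 1 1523 : Fin 5 → ℕ) ∈ KL2.flatten.map (vecOf 5) ∧ (Pi.single 2 1523 : Fin 5 → ℕ) ∈ KL2.flatten.map (vecOf 5) ∧ (Pi.single 3 1960 : Fin 5 → ℕ) ∈ KL2.flatten.map (vecOf 5) ∧ (Pi.single 4 916 : Fin 5 → ℕ) ∈ KL2.flatten.map (vecOf 5) ∧ CL.length = 441 := by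
  refine ⟨?_, ?_, ?_, ?_, ?_, tlen⟩ <;> decide +kernel

end Summit.ResolutionOfSingularities.ResolutionOfSingularities.Theorems.FInjectiveMacaulayfication.P3d4z4557NewtonKFan
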